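import Mathlib
import Literature.Computability.AlgebraicComplexity.RectangularExponentAlpha
import Literature.Computability.AlgebraicComplexity.RectangularExponentHomogeneity
import Literature.Computability.AlgebraicComplexity.KroneckerRank

/-!
# MatrixMultiplication / ShapeSubmodularity — `ShapeSubmodular`, the flat value `ω(x, z, y) = x + y`

Route `ShapeSubmodularity`, crux `ShapeSubmodular` (stmt-MatrixMultiplication-15622), line
`registered` (skeleton `Cruxes/ShapeSubmodular/Lines/birth.lean`, RESHAPE 3), stub `stub_flatValue`.

Write `R⟨k, m, l⟩ = tensorRank (matMulTensor ℂ k m l)` and `α = dualExponentAlpha ℂ`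
(`sup {p | ω(1,p,1) = 2}`).  A natural format `⟨n^x, n^z, n^y⟩` with `1 ≤ y ≤ x` whose inner exponent
is small against the smaller outer one, `z ≤ α · y`, has the flattening exponent `x + y`:
for every `ε > 0`, `R⟨n^x, n^z, n^y⟩ = O(n^{x + y + ε})`.

Proof.  `z / y ≤ α` gives `ω(1, z/y, 1) = 2` (`omegaRect_eq_two_of_le_dualExponentAlpha`), and
homogeneity `ω(1, z/y, 1) = ω(y, z, y) / y` (`omegaRect_one_div_one`) gives `ω(y, z, y) = 2y`; as
`ω(y,z,y)` is the infimum of the admissible exponents of `⟨⌈n^y⌉, ⌈n^z⌉, ⌈n^y⌉⟩ = ⟨n^y, n^z, n^y⟩`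
(`rectDim_natCast`), `2y + ε` is admissible (`exists_lt_of_csInf_lt`, upward closure
`mem_rectAdmissibleExponents_of_le`).  Finally BLOCKING the first outer dimension,
`R⟨n^y · n^(x-y), n^z, n^y⟩ ≤ n^(x-y) · R⟨n^y, n^z, n^y⟩` (Kronecker product with
`⟨n^(x-y), 1, 1⟩` of rank `≤ n^(x-y)`; Bläser 2013, Lemma 5.8 and p. 24:
`Blaser2013_rank_matMulTensor_mul_le`, `tensorRank_matMulTensor_le`), turns `O(n^{2y+ε})` into
`O(n^{(x-y) + 2y + ε}) = O(n^{x+y+ε})`.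
-/

-- the tree's namespace `Summit.MatrixMultiplication.MatrixMultiplication.…` repeats a component by
-- design
set_option linter.dupNamespace false

open Filter Asymptotics
open Literature.Computability.AlgebraicComplexity

namespace Summit.MatrixMultiplication.MatrixMultiplication.Theorems.ShapeSubmodular

/-! ## Blocking and the flat middle exponent -/

/-- Blocking in the first outer dimension: `R⟨k·k', m, l⟩ ≤ k' · R⟨k, m, l⟩` (Kronecker product with
`⟨k', 1, 1⟩`, whose rank is `≤ k'` by the standard algorithm). [cite: Blaser2013, Lemma 5.8 and p. 24] -/
private theorem flat_rank_mul_left_le (k m l k' : ℕ) :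
    tensorRank (matMulTensor ℂ (k * k') m l) ≤ k' * tensorRank (matMulTensor ℂ k m l) := by
  -- adapted from `Theorems.ShapeSubmodular.boundary_rank_mul_left_le` (stub_unitExchangeBoundary)
  have h := Blaser2013_rank_matMulTensor_mul_le ℂ k m l k' 1 1
  rw [mul_one m, mul_one l] at h
  calc tensorRank (matMulTensor ℂ (k * k') m l)
        ≤ tensorRank (matMulTensor ℂ k m l) * tensorRank (matMulTensor ℂ k' 1 1) := h
    _ ≤ tensorRank (matMulTensor ℂ k m l) * k' := by
        refine Nat.mul_le_mul_left _ ?_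
        simpa using tensorRank_matMulTensor_le ℂ k' 1 1
    _ = k' * tensorRank (matMulTensor ℂ k m l) := mul_comm _ _

/-- **`ω(y, z, y) = 2y` for `z ≤ α·y`, `y ≥ 1`**: `ω(1, z/y, 1) = 2` since `z/y ≤ α`, and homogeneity
`ω(1, z/y, 1) = ω(y, z, y) / y`. [folklore] -/
private theorem flat_omegaRect_eq {y z : ℕ} (hy : 1 ≤ y)
    (hz : (z : ℝ) ≤ dualExponentAlpha ℂ * (y : ℝ)) :
    omegaRect ℂ y z y = 2 * y := by
  have hypos : (0 : ℝ) < y := by exact_mod_cast hy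
  have hp : (z : ℝ) / y ≤ dualExponentAlpha ℂ := by
    rw [div_le_iff₀ hypos]
    exact hz
  have h2 := omegaRect_eq_two_of_le_dualExponentAlpha ℂ hp
  rw [omegaRect_one_div_one ℂ z hy, div_eq_iff hypos.ne'] at h2
  exact h2

/-- **`2y + ε` is an admissible exponent of `⟨n^y, n^z, n^y⟩` for `z ≤ α·y`, `y ≥ 1`**:
`R⟨n^y, n^z, n^y⟩ = O(n^{2y + ε})`. [folklore] -/
private theorem flat_isBigO_square {y z : ℕ} (hy : 1 ≤ y)
    (hz : (z : ℝ) ≤ dualExponentAlpha ℂ * (y : ℝ)) {ε : ℝ} (hε : 0 < ε) :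
    (fun n : ℕ => (tensorRank (matMulTensor ℂ (n ^ y) (n ^ z) (n ^ y)) : ℝ)) =O[atTop]
      fun n : ℕ => (n : ℝ) ^ (2 * (y : ℝ) + ε) := by
  have hinf : sInf (rectAdmissibleExponents ℂ (y : ℝ) (z : ℝ) (y : ℝ)) < 2 * (y : ℝ) + ε := by
    have h := flat_omegaRect_eq hy hz
    unfold omegaRect at h
    rw [h]
    linarith
  obtain ⟨β, hβ, hβlt⟩ := exists_lt_of_csInf_lt (rectAdmissibleExponents_nonempty ℂ _ _ _) hinf
  have hmem := mem_rectAdmissibleExponents_of_le hβ hβlt.le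
  have e : (fun n : ℕ =>
      (tensorRank (matMulTensor ℂ (rectDim n y) (rectDim n z) (rectDim n y)) : ℝ)) =
      fun n : ℕ => (tensorRank (matMulTensor ℂ (n ^ y) (n ^ z) (n ^ y)) : ℝ) :=
    funext fun n => by
      rw [tensorRank_matMulTensor_congr ℂ (rectDim_natCast n y) (rectDim_natCast n z)
        (rectDim_natCast n y)]
  rw [← e]
  exact hmem

/-! ## The stub -/

/-- **Flat value** (stub `stub_flatValue` of the line `registered` of crux `ShapeSubmodular`): a natural
format `⟨n^x, n^z, n^y⟩` with `1 ≤ y ≤ x` and `z ≤ α·y` (`α = dualExponentAlpha ℂ`) has the flattening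
exponent `x + y`: for every `ε > 0`, `R⟨n^x, n^z, n^y⟩ = O(n^{x+y+ε})`.  Proof: `ω(y, z, y) = 2y`
(`ω(1, z/y, 1) = 2` and homogeneity), so `R⟨n^y, n^z, n^y⟩ = O(n^{2y+ε})`, and blocking the first outer
dimension `R⟨n^y · n^(x-y), n^z, n^y⟩ ≤ n^(x-y) · R⟨n^y, n^z, n^y⟩`. [folklore] -/
theorem stub_flatValue :
    ∀ x y z : ℕ, 1 ≤ y → y ≤ x →
      (z : ℝ) ≤ Literature.Computability.AlgebraicComplexity.dualExponentAlpha ℂ * (y : ℝ) →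
      ∀ ε : ℝ, 0 < ε →
        (fun n : ℕ => (Literature.Computability.AlgebraicComplexity.tensorRank
          (Literature.Computability.AlgebraicComplexity.matMulTensor ℂ (n ^ x) (n ^ z) (n ^ y)) : ℝ))
            =O[Filter.atTop] (fun n : ℕ => (n : ℝ) ^ ((x : ℝ) + (y : ℝ) + ε)) := by
  intro x y z hy hyx hz ε hε
  -- `R⟨n^y, n^z, n^y⟩ = O(n^{2y+ε})`
  have hO := flat_isBigO_square hy hz hε
  -- blocking: `R⟨n^x, n^z, n^y⟩ ≤ n^(x-y) · R⟨n^y, n^z, n^y⟩`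
  have hblock : ∀ n : ℕ, tensorRank (matMulTensor ℂ (n ^ x) (n ^ z) (n ^ y)) ≤
      n ^ (x - y) * tensorRank (matMulTensor ℂ (n ^ y) (n ^ z) (n ^ y)) := fun n =>
    calc tensorRank (matMulTensor ℂ (n ^ x) (n ^ z) (n ^ y))
          = tensorRank (matMulTensor ℂ (n ^ y * n ^ (x - y)) (n ^ z) (n ^ y)) :=
        tensorRank_matMulTensor_congr ℂ (by rw [← pow_add, Nat.add_sub_of_le hyx]) rfl rfl
      _ ≤ n ^ (x - y) * tensorRank (matMulTensor ℂ (n ^ y) (n ^ z) (n ^ y)) :=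
        flat_rank_mul_left_le _ _ _ _
  have h1 : (fun n : ℕ => (tensorRank (matMulTensor ℂ (n ^ x) (n ^ z) (n ^ y)) : ℝ)) =O[atTop]
      fun n : ℕ => (n : ℝ) ^ (x - y) *
        (tensorRank (matMulTensor ℂ (n ^ y) (n ^ z) (n ^ y)) : ℝ) := by
    refine IsBigO.of_bound 1 (Eventually.of_forall fun n => ?_)
    rw [one_mul, Real.norm_of_nonneg (Nat.cast_nonneg _), Real.norm_of_nonneg (by positivity)]
    exact_mod_cast hblock n
  have h2 : (fun n : ℕ => (n : ℝ) ^ (x - y) *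
      (tensorRank (matMulTensor ℂ (n ^ y) (n ^ z) (n ^ y)) : ℝ)) =O[atTop]
      fun n : ℕ => (n : ℝ) ^ (x - y) * (n : ℝ) ^ (2 * (y : ℝ) + ε) :=
    (isBigO_refl (fun n : ℕ => (n : ℝ) ^ (x - y)) atTop).mul hO
  have h3 : (fun n : ℕ => (n : ℝ) ^ (x - y) * (n : ℝ) ^ (2 * (y : ℝ) + ε)) =ᶠ[atTop]
      fun n : ℕ => (n : ℝ) ^ ((x : ℝ) + (y : ℝ) + ε) := by
    filter_upwards [eventually_gt_atTop 0] with n hn0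
    have hn : (0 : ℝ) < n := Nat.cast_pos.2 hn0
    rw [← Real.rpow_natCast, ← Real.rpow_add hn, Nat.cast_sub hyx]
    congr 1
    ring
  exact (h1.trans h2).trans h3.isBigO

end Summit.MatrixMultiplication.MatrixMultiplication.Theorems.ShapeSubmodular
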